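import Mathlib

/-!
# `TwinAlgMuZeroAtThree` · card `one-point-squeeze` · g74 — U2 IS EXACT IN THE KOBAYASHI–KITAJIMA–OTSUKI MODEL

Seat `bsd-wall-utd-idea` g74 (ideation planner, crux item stmt-BirchSwinnertonDyer-24737).  Mathlib only, no
`sorry`; nothing here is a tree theorem about the summit.  These are the kernel-checked ALGEBRA pieces of the g74
amendment of `Ideas/one-point-squeeze.md` («U2 closed in the model: the local isotypic defect is
`d_χ = 3^b · kobDefect 3 (m - b)` EXACTLY, `δ_χ = 0`»), each with its dictionary.

THE SETTING (card §13/§14, g72 descent, g73 residual U2).  `K_𝔭 = ℚ₃` (split `𝔭 ∣ 3`), `Γ = Gal(K_∞/K) ≅ ℤ₃`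
(anticyclotomic), `χ` of exact order `3^m` on `Γ_m`, `O = O_χ = ℤ₃[ζ]`, `π = ζ - 1`.  Let `I ⊆ D ⊆ Γ` be the
inertia and decomposition groups of a prime `w ∣ 𝔭` of `K_∞`: `[Γ : D] = 3^{s₀}`, `[D : I] = 3^a`, `b := s₀ + a`
(`I_𝔭 = I_{𝔭̄}` because conjugation inverts `Γ`, so `K_∞^I ⊆ H_K ∩ K_∞` and `b ≤ v₃(h_K)`; `b = 0` when `3 ∤ h_K`,
e.g. on the habitat `17a1′/ℚ(√-35)`, `h_K = 2`).  `F := K_{m,w}`: `G_F = Gal(F/ℚ₃)` cyclic of order `3^{a+n}`,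
`n := m - b` ramified levels, unramified prefix `k^a/ℚ₃` of degree `3^a`; `γ_F` a generator, `X ↦ γ_F - 1`,
`χ_F := χ|_{G_F}`, `ζ_F := χ(γ_F) = ζ^{3^{s₀}}`, `t := ζ̄_F - 1`, `θ := X - C t`.
`M := Ê′(𝔪_F) ⊗ O` (height-2 Lubin–Tate formal group, `a₃(E′) = 0`), an `O[X]`-module killed by
`ω := (1+X)^{3^{a+n}} - 1`.  The χ̄-isotypic line is `U := M[θ]`, the resolvent is
`R := Σ_{j<3^{a+n}} χ_F(γ_F^j)·γ_F^j = Σ_j (ζ_F (1+X))^j`, and the LOCAL DEFECT of the card is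
`d_χ := length_O (U / O·R(M))`.  (Semi-local = local: `y ↦ Σ_{g ∈ Γ_m/G_F} χ(g)·g y` is an isomorphism
`U(M_w) ≅ U(⊕_{w'} M_{w'})` carrying `R_{χ_F}(x)` to `R_χ(x)`, Frobenius reciprocity; so `d_χ` may be computed at
one `w`.)

THE MODEL (Kitajima–Otsuki arXiv:1607.03612: Lemma 3.15 p.10, Prop 3.16(2) p.10 `0 → Ê(𝔪_{-1}) → 𝒞(𝔪_n) ⊕
𝒞(𝔪_{n-1}) → Ê(𝔪_n) → 0`, Rem 3.17 p.11, Prop 3.22 p.12 + Rem 3.23 p.13 `Ê^±(𝔪_n)^{χ=1} ≅ ℤ_p[G_{-1}][X]/(ω_n^±)`;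
descended to `F` by g72, `Ĥ*(H, ·) = 0`).  With `Y := ω_a(X) = (1+X)^{3^a} - 1`,
`Π_± := ∏_{1 ≤ k ≤ n, k ∈ P^±} Φ_{3^{a+k}}(1+X)` (`P⁺` = even, `P⁻` = odd `k`), `ω = Y·Π₊·Π₋`:
  `E^± ≅ O[X]/(Y·Π_±)` cyclic,   `E⁺ + E⁻ = M`,   `E⁺ ∩ E⁻ = D := Ê′(𝔪_{k^a}) ⊗ O = (Y-torsion of E^∓) = Π_∓·E^∓`.
Let `ε` := parity of `n`; `θ ∣ Π_ε` (top level), so `Y·Π_ε = θ·F₁`;  put `Fc := Π_{-ε}` (the ABSENT lower levels),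
`θ·F₁·Fc = ω`, and `Fc(t) ≠ 0`, `(Y·Π_{-ε})(t) ≠ 0` (both divide `ω/θ`, and `t` is a SIMPLE root of `ω`:
`ω'(t) = N(1+t)^{N-1}` is non-zero in characteristic `0`).
DICTIONARY for §2: `E₁ := E^ε = O[X]·c₁` with `ann(c₁) = (θ·F₁)`;  `E₂ := E^{-ε} = O[X]·c₂` with
`ann(c₂) = (g)`, `g := Y·Π_{-ε}`, `g(t) ≠ 0`;  `q·c₂ ∈ E₁ ↔ Π_{-ε} ∣ q` (the intersection is the `Y`-torsion);
`ζ := ζ_F`, `N := 3^{a+n}`, `ζ^N = 1`, `ζ·(t+1) = 1`.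

WHAT IS PROVED (all hypotheses are the displayed model identities; `O` any commutative domain):
* §1  one linear factor: cancellation, `F₁·w ≡ w(t)·F₁ (mod θF₁)`, torsion-freeness of the line, and the
  RESOLVENT COORDINATE `R = C(t+1)·F₁·Fc` in `O[X]` (from `R·(ζ(1+X) - 1) = (1+X)^N - 1`, g65 `resolvent_mul_eq`).
* §2  the model theorem:  (i) `M[θ] = {(C a·F₁)·c₁ : a ∈ O} ≅ O` (`isotypic_line_of_model`, `line_mem_torsion`,
  `line_torsionFree`) — in particular `δ_χ = 0`: NO isotypic vector comes from `E^{-ε}` beyond `D ⊆ E^ε`, because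
  `θ·e ∈ E^ε ⇒ e ∈ E^ε` for `e ∈ E^{-ε}` (`strong_exchange_of_model`: `Π_{-ε} ∣ θq ⇒ Π_{-ε} ∣ q` as `Π_{-ε}(t) ≠ 0`);
  (ii) `R·c₂ = 0`, `R·c₁ = (C((t+1)·Fc(t))·F₁)·c₁` and `R·M = O·(t+1)Fc(t)·u`, `u := F₁·c₁`
  (`resolvent_kills_E₂`, `resolvent_on_generator`, `resolvent_of_model`).  Hence, `t+1 = ζ̄_F` being a unit,
        `d_χ = length_O (O/(Fc(t))) = v_π(Π_{-ε}(ζ̄_F - 1))`.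
* §3  the count: `v_π(Π_{-ε}(ζ̄_F - 1)) = 3^{s₀}·deg Π_{-ε}` (each lower-level root `η` costs `‖ζ̄_F - η‖ =
  3^{-1/φ(3^{m-s₀})}`, g65 `norm_prod_sub_lower_level_roots` at level `m - s₀`, and `φ(3^m) = 3^{s₀}·φ(3^{m-s₀})`),
  `deg Π_{-ε} = Σ_{1≤k<n, k≢n} φ(3^{a+k}) = 3^a·kobDefect 3 n` (`sum_shifted_levels`).  So
        `d_χ = 3^b · kobDefect 3 (m - b)`,   `kobDefect 3 m = 3^b·kobDefect 3 (m-b) + c_b(m)`,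
        `0 ≤ c_b(m) = Σ_{1≤k≤b, k≢m (2)} φ(3^k) ≤ 3^b - 1`      (`kobDefect_shift`, `correction_succ_le`,
  `local_vs_global_defect`): U2 («`d_χ - kobDefect 3 m = O(1)`») holds with the explicit constant `3^b - 1`, and
  with ERROR ZERO when `𝔭` is totally ramified in `K_∞/K` (`b = 0`).  Budget: `2·d_χ ≤ 2·kobDefect 3 m ≤ (3/4)·φ(3^m)`
  (g65 `two_mul_kobDefect_three_le`).  Exact prediction for F5″ on `b = 0` habitats: `d_χ = 0, 0, 2, 6, 20, 60, 182`
  for `m = 0, …, 6` (`kobDefect_three_table`).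
-/

namespace Summit.BirchSwinnertonDyer.BirchSwinnertonDyer.Cruxes.TwinAlgMuZeroAtThree.OnePointSqueeze.KobayashiDefectExact

open Polynomial

/-! ## §1  One linear factor `θ = X - C t` in `A[X]` -/

section LinearFactor

variable {A : Type*} [CommRing A]

/-- Cancellation of the monic factor: `θ·u = θ·F₁·w ⇒ u = F₁·w`. -/
theorem eq_mul_of_linear_mul_eq {t : A} {F₁ u w : A[X]} (h : (X - C t) * u = (X - C t) * F₁ * w) :
    u = F₁ * w :=
  (monic_X_sub_C t).isRegular.left (by simpa [mul_assoc] using h)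

/-- `F₁·w ≡ w(t)·F₁ (mod θ·F₁)`: the `O[X]`-action on the isotypic line factors through evaluation at `t`. -/
theorem linear_mul_dvd_mul_sub (t : A) (F₁ w : A[X]) :
    (X - C t) * F₁ ∣ F₁ * w - C (w.eval t) * F₁ := by
  obtain ⟨q, hq⟩ := (X_sub_C_dvd_sub_C_eval : X - C t ∣ w - C (w.eval t))
  exact ⟨q, by linear_combination F₁ * hq⟩

/-- Torsion-freeness of the line: `θ·F₁ ∣ C a·F₁` with `F₁` monic forces `a = 0`. -/
theorem eq_zero_of_dvd_C_mul {t a : A} {F₁ : A[X]} (hF₁ : F₁.Monic) (h : (X - C t) * F₁ ∣ C a * F₁) :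
    a = 0 := by
  obtain ⟨q, hq⟩ := h
  have h1 : F₁ * C a = F₁ * ((X - C t) * q) := by linear_combination hq
  have h2 : C a = (X - C t) * q := hF₁.isRegular.left h1
  have h3 := congrArg (eval t) h2
  simpa using h3

/-- If `g(t)` is a non-zero-divisor witness (`g(t) ≠ 0` in a domain) then `g ∣ θ·q ⇒ g ∣ q`. -/
theorem dvd_of_dvd_linear_mul [IsDomain A] {t : A} {g q : A[X]} (hg : g.eval t ≠ 0)
    (h : g ∣ (X - C t) * q) : g ∣ q := by
  obtain ⟨r, hr⟩ := h
  have hroot : r.eval t = 0 := by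
    have h1 := congrArg (eval t) hr
    simp only [eval_mul, eval_sub, eval_X, eval_C, sub_self, zero_mul] at h1
    exact (mul_eq_zero.mp h1.symm).resolve_left hg
  obtain ⟨r₁, hr₁⟩ := (dvd_iff_isRoot.mpr (IsRoot.def.mpr hroot) : X - C t ∣ r)
  refine ⟨r₁, (monic_X_sub_C t).isRegular.left ?_⟩
  show (X - C t) * q = (X - C t) * (g * r₁)
  rw [hr, hr₁]; ring

/-- THE RESOLVENT COORDINATE (g65 `resolvent_mul_eq`, made explicit).  With `ζ^N = 1`, `ζ·(t+1) = 1` and the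
factorisation `θ·F₁·Fc = (1+X)^N - 1`, the resolvent `R = Σ_{j<N} (ζ(1+X))^j` equals `C(t+1)·F₁·Fc` in `A[X]`. -/
theorem resolvent_coordinate (ζ t : A) (N : ℕ) (hζ : ζ ^ N = 1) (ht : ζ * (t + 1) = 1) (F₁ Fc : A[X])
    (hfac : (X - C t) * F₁ * Fc = (X + 1) ^ N - 1) :
    ∑ j ∈ Finset.range N, (C ζ * (X + 1)) ^ j = C (t + 1) * F₁ * Fc := by
  set R := ∑ j ∈ Finset.range N, (C ζ * (X + 1)) ^ j with hR
  have hgeom : R * (C ζ * (X + 1) - 1) = (X + 1) ^ N - 1 := by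
    rw [hR, geom_sum_mul, mul_pow, ← C_pow, hζ, C_1, one_mul]
  have hu : C ζ * C (t + 1) = (1 : A[X]) := by rw [← C_mul, ht, C_1]
  have hlin : C ζ * (X - C t) = C ζ * (X + 1) - 1 := by
    rw [map_add, C_1] at hu
    linear_combination -hu
  have hkey : (X - C t) * (C ζ * R) = (X - C t) * (F₁ * Fc) := by
    calc (X - C t) * (C ζ * R) = R * (C ζ * (X - C t)) := by ring
      _ = R * (C ζ * (X + 1) - 1) := by rw [hlin]
      _ = (X + 1) ^ N - 1 := hgeom
      _ = (X - C t) * (F₁ * Fc) := by rw [← hfac, mul_assoc]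
  have h2 : C ζ * R = F₁ * Fc := (monic_X_sub_C t).isRegular.left hkey
  calc R = (C ζ * C (t + 1)) * R := by rw [hu, one_mul]
    _ = C (t + 1) * (C ζ * R) := by ring
    _ = C (t + 1) * (F₁ * Fc) := by rw [h2]
    _ = C (t + 1) * F₁ * Fc := by ring

/-- `θ·R = C(t+1)·((1+X)^N - 1)`: the resolvent lands in the `θ`-torsion of any module killed by `(1+X)^N - 1`. -/
theorem linear_mul_resolvent (ζ t : A) (N : ℕ) (hζ : ζ ^ N = 1) (ht : ζ * (t + 1) = 1) :
    (X - C t) * ∑ j ∈ Finset.range N, (C ζ * (X + 1)) ^ j = C (t + 1) * ((X + 1) ^ N - 1) := by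
  set R := ∑ j ∈ Finset.range N, (C ζ * (X + 1)) ^ j with hR
  have hgeom : R * (C ζ * (X + 1) - 1) = (X + 1) ^ N - 1 := by
    rw [hR, geom_sum_mul, mul_pow, ← C_pow, hζ, C_1, one_mul]
  have hu : C ζ * C (t + 1) = (1 : A[X]) := by rw [← C_mul, ht, C_1]
  have hlin : C ζ * (X - C t) = C ζ * (X + 1) - 1 := by
    have hu' := hu
    rw [map_add, C_1] at hu'
    linear_combination -hu'
  calc (X - C t) * R = C (t + 1) * (R * (C ζ * (X - C t))) := by
        linear_combination (-(X - C t) * R) * hu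
    _ = C (t + 1) * ((X + 1) ^ N - 1) := by rw [hlin, hgeom]

end LinearFactor

/-! ## §2  The model theorem: the isotypic line and the resolvent line of `M = E₁ + E₂` -/

section Model

variable {O : Type*} [CommRing O] {M : Type*} [AddCommGroup M] [Module O[X] M]

/-- The `θ`-torsion of the cyclic module `O[X]·c₁`, `ann(c₁) = (θ·F₁)`, is the `O`-line through `u = F₁·c₁`. -/
theorem torsion_of_cyclic {t : O} {F₁ : O[X]} (c₁ : M)
    (hann₁ : ∀ q : O[X], q • c₁ = 0 ↔ (X - C t) * F₁ ∣ q) (q : O[X])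
    (hq : (X - C t) • (q • c₁) = 0) : ∃ a : O, q • c₁ = (C a * F₁) • c₁ := by
  rw [smul_smul] at hq
  obtain ⟨w, hw⟩ := (hann₁ _).mp hq
  have hqw : q = F₁ * w := eq_mul_of_linear_mul_eq hw
  refine ⟨w.eval t, ?_⟩
  rw [hqw, ← sub_eq_zero, ← sub_smul]
  exact (hann₁ _).mpr (linear_mul_dvd_mul_sub t F₁ w)

/-- Every point of the line is `θ`-torsion. -/
theorem line_mem_torsion {t : O} {F₁ : O[X]} (c₁ : M)
    (hann₁ : ∀ q : O[X], q • c₁ = 0 ↔ (X - C t) * F₁ ∣ q) (a : O) :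
    (X - C t) • ((C a * F₁) • c₁) = 0 := by
  rw [smul_smul]
  exact (hann₁ _).mpr ⟨C a, by ring⟩

/-- The line is torsion-free: its coordinate `a` is unique (`F₁` monic). -/
theorem line_torsionFree {t : O} {F₁ : O[X]} (hF₁ : F₁.Monic) (c₁ : M)
    (hann₁ : ∀ q : O[X], q • c₁ = 0 ↔ (X - C t) * F₁ ∣ q) (a : O) (h : (C a * F₁) • c₁ = 0) : a = 0 :=
  eq_zero_of_dvd_C_mul hF₁ ((hann₁ _).mp h)

/-- `O[X]` acts on the line through `q ↦ q(t)`. -/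
theorem action_on_line {t : O} {F₁ : O[X]} (c₁ : M)
    (hann₁ : ∀ q : O[X], q • c₁ = 0 ↔ (X - C t) * F₁ ∣ q) (q : O[X]) (a : O) :
    q • ((C a * F₁) • c₁) = (C (q.eval t * a) * F₁) • c₁ := by
  rw [smul_smul, ← sub_eq_zero, ← sub_smul]
  refine (hann₁ _).mpr ?_
  have h := linear_mul_dvd_mul_sub t F₁ (C a * q)
  have he : (C a * q).eval t = q.eval t * a := by simp [mul_comm]
  rw [he] at h
  obtain ⟨r, hr⟩ := h
  exact ⟨r, by linear_combination hr⟩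

/-- THE EXCHANGE LEMMA (`δ_χ = 0`): in `E₂ = O[X]·c₂` with `E₁ ∩ E₂ = Π·E₂` and `Π(t) ≠ 0`,
`θ·e ∈ E₁ ⇒ e ∈ E₁` for every `e ∈ E₂`.  (Model: `Π = Π_{-ε}` has only lower-level roots.) -/
theorem strong_exchange_of_model [IsDomain O] {t : O} {Pc : O[X]} (hPc : Pc.eval t ≠ 0)
    (E₁ : Submodule O[X] M) (c₂ : M) (hI : ∀ q : O[X], q • c₂ ∈ E₁ ↔ Pc ∣ q) (q : O[X])
    (h : (X - C t) • (q • c₂) ∈ E₁) : q • c₂ ∈ E₁ := by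
  rw [smul_smul] at h
  exact (hI q).mpr (dvd_of_dvd_linear_mul hPc ((hI _).mp h))

/-- `E₂` has no `θ`-torsion (`g = ann(c₂)` has `g(t) ≠ 0`). -/
theorem torsionFree_E₂ [IsDomain O] {t : O} {g : O[X]} (hg : g.eval t ≠ 0) (c₂ : M)
    (hann₂ : ∀ q : O[X], q • c₂ = 0 ↔ g ∣ q) (q : O[X]) (h : (X - C t) • (q • c₂) = 0) : q • c₂ = 0 := by
  rw [smul_smul] at h
  exact (hann₂ q).mpr (dvd_of_dvd_linear_mul hg ((hann₂ _).mp h))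

/-- **THE ISOTYPIC LINE OF THE MODEL.**  If `M = O[X]·c₁ + O[X]·c₂`, `ann(c₁) = (θ·F₁)`,
`(O[X]·c₂) ∩ E₁ = Π·c₂` with `Π(t) ≠ 0` (where `E₁ ∋ c₁` is an `O[X]`-submodule, in the model `E₁ = O[X]·c₁`),
then every `θ`-torsion element of `M` lies on the line `O·(F₁·c₁)`:  `M[θ] = E₁[θ] = O·u`. -/
theorem isotypic_line_of_model [IsDomain O] {t : O} {F₁ Pc : O[X]} (hPc : Pc.eval t ≠ 0)
    (E₁ : Submodule O[X] M) (c₁ c₂ : M) (hc₁ : c₁ ∈ E₁)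
    (hE₁ : ∀ e ∈ E₁, ∃ q : O[X], e = q • c₁)
    (hann₁ : ∀ q : O[X], q • c₁ = 0 ↔ (X - C t) * F₁ ∣ q)
    (hI : ∀ q : O[X], q • c₂ ∈ E₁ ↔ Pc ∣ q)
    (hsup : ∀ m : M, ∃ q₁ q₂ : O[X], m = q₁ • c₁ + q₂ • c₂)
    (m : M) (hm : (X - C t) • m = 0) : ∃ a : O, m = (C a * F₁) • c₁ := by
  obtain ⟨q₁, q₂, rfl⟩ := hsup m
  have h1 : (X - C t) • (q₁ • c₁) ∈ E₁ := E₁.smul_mem _ (E₁.smul_mem _ hc₁)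
  have h2 : (X - C t) • (q₂ • c₂) ∈ E₁ := by
    have : (X - C t) • (q₂ • c₂) = -((X - C t) • (q₁ • c₁)) := by
      rw [smul_add] at hm
      exact eq_neg_of_add_eq_zero_right hm
    rw [this]
    exact E₁.neg_mem h1
  have h3 : q₂ • c₂ ∈ E₁ := strong_exchange_of_model hPc E₁ c₂ hI q₂ h2
  obtain ⟨q₃, hq₃⟩ := hE₁ _ h3
  rw [hq₃, ← add_smul] at hm ⊢
  exact torsion_of_cyclic c₁ hann₁ (q₁ + q₃) hm

/-- The resolvent kills `E₂` (it maps into the `θ`-torsion, which `E₂` lacks). -/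
theorem resolvent_kills_E₂ [IsDomain O] (ζ t : O) (N : ℕ) (hζ : ζ ^ N = 1) (ht : ζ * (t + 1) = 1)
    {g : O[X]} (hg : g.eval t ≠ 0) (c₂ : M) (hann₂ : ∀ q : O[X], q • c₂ = 0 ↔ g ∣ q)
    (hω : ((X + 1) ^ N - 1 : O[X]) • c₂ = 0) (q : O[X]) :
    (∑ j ∈ Finset.range N, (C ζ * (X + 1)) ^ j) • (q • c₂) = 0 := by
  suffices h : (∑ j ∈ Finset.range N, (C ζ * (X + 1)) ^ j) • c₂ = 0 by
    rw [smul_smul, mul_comm, ← smul_smul, h, smul_zero]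
  apply torsionFree_E₂ hg c₂ hann₂
  rw [smul_smul, linear_mul_resolvent ζ t N hζ ht, ← smul_smul, hω, smul_zero]

/-- The resolvent on the generator of `E₁`: `R·c₁ = (C((t+1)·Fc(t))·F₁)·c₁`, i.e. `R·c₁ = (t+1)·Fc(t)·u`. -/
theorem resolvent_on_generator (ζ t : O) (N : ℕ) (hζ : ζ ^ N = 1) (ht : ζ * (t + 1) = 1) (F₁ Fc : O[X])
    (hfac : (X - C t) * F₁ * Fc = (X + 1) ^ N - 1) (c₁ : M)
    (hann₁ : ∀ q : O[X], q • c₁ = 0 ↔ (X - C t) * F₁ ∣ q) :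
    (∑ j ∈ Finset.range N, (C ζ * (X + 1)) ^ j) • c₁ = (C ((t + 1) * Fc.eval t) * F₁) • c₁ := by
  rw [resolvent_coordinate ζ t N hζ ht F₁ Fc hfac, ← sub_eq_zero, ← sub_smul]
  refine (hann₁ _).mpr ?_
  have h := linear_mul_dvd_mul_sub t F₁ (C (t + 1) * Fc)
  have he : (C (t + 1) * Fc).eval t = (t + 1) * Fc.eval t := by simp
  rw [he] at h
  obtain ⟨r, hr⟩ := h
  exact ⟨r, by linear_combination hr⟩

/-- **THE RESOLVENT LINE OF THE MODEL.**  `R·M = O·(t+1)Fc(t)·u`: every `R·m` is an `O`-multiple of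
`(t+1)Fc(t)·u` (and `R·c₁` is that vector, `resolvent_on_generator`).  With `isotypic_line_of_model` this is the
formula `d_χ = length_O (O / (Fc(t)))` (`t + 1 = ζ̄_F` is a unit). -/
theorem resolvent_of_model [IsDomain O] (ζ t : O) (N : ℕ) (hζ : ζ ^ N = 1) (ht : ζ * (t + 1) = 1)
    (F₁ Fc : O[X]) (hfac : (X - C t) * F₁ * Fc = (X + 1) ^ N - 1)
    {g : O[X]} (hg : g.eval t ≠ 0) (c₁ c₂ : M)
    (hann₁ : ∀ q : O[X], q • c₁ = 0 ↔ (X - C t) * F₁ ∣ q)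
    (hann₂ : ∀ q : O[X], q • c₂ = 0 ↔ g ∣ q) (hω : ((X + 1) ^ N - 1 : O[X]) • c₂ = 0)
    (hsup : ∀ m : M, ∃ q₁ q₂ : O[X], m = q₁ • c₁ + q₂ • c₂) (m : M) :
    ∃ a : O, (∑ j ∈ Finset.range N, (C ζ * (X + 1)) ^ j) • m
      = (C (a * ((t + 1) * Fc.eval t)) * F₁) • c₁ := by
  obtain ⟨q₁, q₂, rfl⟩ := hsup m
  refine ⟨q₁.eval t, ?_⟩
  rw [smul_add, resolvent_kills_E₂ ζ t N hζ ht hg c₂ hann₂ hω q₂, add_zero, smul_smul, mul_comm, ← smul_smul,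
    resolvent_on_generator ζ t N hζ ht F₁ Fc hfac c₁ hann₁, action_on_line c₁ hann₁]

/-- The unit `t + 1` does not change the index: `(u·x) = (x)` as ideals. -/
theorem span_unit_mul {t x : O} {ζ : O} (ht : ζ * (t + 1) = 1) :
    Ideal.span {(t + 1) * x} = Ideal.span {x} :=
  Ideal.span_singleton_mul_left_unit (IsUnit.of_mul_eq_one_right ζ ht) x

end Model

/-! ## §3  The count: local versus global Kobayashi defect -/

section Count

/-- **Kobayashi defect** (verbatim copy of g65 §13): `Σ φ(p^k)` over `1 ≤ k < n`, `k ≢ n (mod 2)`. -/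
def kobDefect (p n : ℕ) : ℕ := ∑ k ∈ Finset.Ico 1 n, if k % 2 = n % 2 then 0 else Nat.totient (p ^ k)

theorem kobDefect_zero (p : ℕ) : kobDefect p 0 = 0 := by simp [kobDefect]

theorem kobDefect_one (p : ℕ) : kobDefect p 1 = 0 := by simp [kobDefect]

/-- The recursion `d_{n+2} = d_n + φ(p^{n+1})` (g65, PROVED). -/
theorem kobDefect_add_two (p n : ℕ) : kobDefect p (n + 2) = kobDefect p n + Nat.totient (p ^ (n + 1)) := by
  rcases Nat.eq_zero_or_pos n with rfl | hn
  · simp [kobDefect]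
  · unfold kobDefect
    simp_rw [Nat.add_mod_right]
    rw [Finset.sum_Ico_succ_top (by omega), Finset.sum_Ico_succ_top (by omega)]
    have h1 : (n + 1) % 2 ≠ n % 2 := by omega
    simp [h1]

/-- Exact prediction table for F5″ on `b = 0` habitats: `d_χ = kobDefect 3 m = 0,0,2,6,20,60,182` (`m = 0..6`). -/
theorem kobDefect_three_table :
    kobDefect 3 0 = 0 ∧ kobDefect 3 1 = 0 ∧ kobDefect 3 2 = 2 ∧ kobDefect 3 3 = 6 ∧ kobDefect 3 4 = 20 ∧
      kobDefect 3 5 = 60 ∧ kobDefect 3 6 = 182 := by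
  have h2 : kobDefect 3 2 = 2 := by decide
  have h3 : kobDefect 3 3 = 6 := by decide
  have h4 : kobDefect 3 4 = 20 := by rw [kobDefect_add_two, h2, Nat.totient_prime_pow_succ Nat.prime_three]; norm_num
  have h5 : kobDefect 3 5 = 60 := by rw [kobDefect_add_two, h3, Nat.totient_prime_pow_succ Nat.prime_three]; norm_num
  have h6 : kobDefect 3 6 = 182 := by
    rw [kobDefect_add_two, h4, Nat.totient_prime_pow_succ Nat.prime_three]; norm_num
  exact ⟨kobDefect_zero 3, kobDefect_one 3, h2, h3, h4, h5, h6⟩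

/-- `φ(p^{b+k}) = p^b·φ(p^k)` for `k ≥ 1` (used twice: the levels above an unramified prefix of height `a`,
and the rescaling of lengths `[O_χ : O_{χ_F}] = φ(3^m)/φ(3^{m-s₀}) = 3^{s₀}`). -/
theorem totient_prime_pow_add {p : ℕ} (hp : p.Prime) (b k : ℕ) (hk : 1 ≤ k) :
    Nat.totient (p ^ (b + k)) = p ^ b * Nat.totient (p ^ k) := by
  obtain ⟨j, rfl⟩ : ∃ j, k = j + 1 := ⟨k - 1, by omega⟩
  rw [← add_assoc, Nat.totient_prime_pow_succ hp, Nat.totient_prime_pow_succ hp, pow_add]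
  ring

/-- `deg Π_{-ε} = Σ_{1 ≤ k < n, k ≢ n (2)} φ(p^{a+k}) = p^a · kobDefect p n` (the absent levels sit at
heights `a + k` above the unramified prefix). -/
theorem sum_shifted_levels {p : ℕ} (hp : p.Prime) (a n : ℕ) :
    (∑ k ∈ Finset.Ico 1 n, if k % 2 = n % 2 then 0 else Nat.totient (p ^ (a + k)))
      = p ^ a * kobDefect p n := by
  unfold kobDefect
  rw [Finset.mul_sum]
  refine Finset.sum_congr rfl fun k hk => ?_
  have hk1 : 1 ≤ k := (Finset.mem_Ico.mp hk).1
  split_ifs with h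
  · simp
  · exact totient_prime_pow_add hp a k hk1

/-- `Σ_{1 ≤ k ≤ b} φ(p^k) + 1 = p^b`. -/
theorem sum_totient_levels {p : ℕ} (hp : p.Prime) : ∀ b : ℕ,
    (∑ k ∈ Finset.Ico 1 (b + 1), Nat.totient (p ^ k)) + 1 = p ^ b
  | 0 => by simp
  | b + 1 => by
      rw [Finset.sum_Ico_succ_top (by omega : 1 ≤ b + 1), add_right_comm, sum_totient_levels hp b,
        Nat.totient_prime_pow_succ hp, pow_succ]
      obtain ⟨q, rfl⟩ : ∃ q, p = q + 1 := ⟨p - 1, by have := hp.one_lt; omega⟩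
      rw [Nat.add_sub_cancel]
      ring

/-- The correction term `c_b = Σ_{1 ≤ k ≤ b, k ≢ c} φ(p^k)` satisfies `c_b + 1 ≤ p^b`. -/
theorem correction_succ_le {p : ℕ} (hp : p.Prime) (b c : ℕ) :
    (∑ k ∈ Finset.Ico 1 (b + 1), if k % 2 = c then 0 else Nat.totient (p ^ k)) + 1 ≤ p ^ b := by
  calc _ ≤ (∑ k ∈ Finset.Ico 1 (b + 1), Nat.totient (p ^ k)) + 1 :=
        Nat.add_le_add_right (Finset.sum_le_sum fun k _ => by split_ifs <;> simp) 1
    _ = p ^ b := sum_totient_levels hp b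

/-- **GLOBAL = p^b · LOCAL + correction**:
`kobDefect p (b+n) = Σ_{1≤k≤b, k≢b+n} φ(p^k) + p^b · kobDefect p n` (`n ≥ 1`). -/
theorem kobDefect_shift {p : ℕ} (hp : p.Prime) (b n : ℕ) (hn : 1 ≤ n) :
    kobDefect p (b + n)
      = (∑ k ∈ Finset.Ico 1 (b + 1), if k % 2 = (b + n) % 2 then 0 else Nat.totient (p ^ k))
        + p ^ b * kobDefect p n := by
  rw [← sum_shifted_levels hp b n]
  unfold kobDefect
  rw [← Finset.sum_Ico_consecutive _ (show 1 ≤ b + 1 by omega) (show b + 1 ≤ b + n by omega)]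
  congr 1
  rw [Finset.sum_Ico_eq_sum_range, Finset.sum_Ico_eq_sum_range]
  have hlen : b + n - (b + 1) = n - 1 := by omega
  rw [hlen]
  refine Finset.sum_congr rfl fun k _ => ?_
  have hiff : (b + 1 + k) % 2 = (b + n) % 2 ↔ (1 + k) % 2 = n % 2 := by omega
  have hexp : b + (1 + k) = b + 1 + k := by omega
  simp only [hiff, hexp]

/-- **U2 WITH ITS CONSTANT**: `p^b·kobDefect p n ≤ kobDefect p (b+n) ≤ p^b·kobDefect p n + (p^b - 1)`; in the
dictionary (`p = 3`, `n = m - b`, `d_χ = 3^b·kobDefect 3 (m-b)`): `0 ≤ kobDefect 3 m - d_χ ≤ 3^b - 1`. -/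
theorem local_vs_global_defect {p : ℕ} (hp : p.Prime) (b n : ℕ) (hn : 1 ≤ n) :
    p ^ b * kobDefect p n ≤ kobDefect p (b + n) ∧
      kobDefect p (b + n) + 1 ≤ p ^ b * kobDefect p n + p ^ b := by
  have h := kobDefect_shift hp b n hn
  have hc := correction_succ_le hp b ((b + n) % 2)
  constructor <;> omega

/-- Sanity instance of the shift (`p = 3`, `b = 1`, `n = 3`): `kobDefect 3 4 = 20 = 3·6 + φ(3)`. -/
example : kobDefect 3 4 = 3 * kobDefect 3 3 + 2 := by
  obtain ⟨-, -, -, h3, h4, -, -⟩ := kobDefect_three_table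
  rw [h3, h4]

/-- Sanity instance with `b = 2`, `n = 2`: `kobDefect 3 4 = 9·kobDefect 3 2 + φ(3) = 18 + 2`
(levels `k = 1` counted, `k = 2 ≡ 4` not). -/
example : kobDefect 3 4 = 9 * kobDefect 3 2 + 2 := by
  obtain ⟨-, -, h2, -, h4, -, -⟩ := kobDefect_three_table
  rw [h2, h4]

end Count

end Summit.BirchSwinnertonDyer.BirchSwinnertonDyer.Cruxes.TwinAlgMuZeroAtThree.OnePointSqueeze.KobayashiDefectExact
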